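/-
Copyright (c) 2026 the pub-hodgecm-mathlib formalisation cell (harness21).  Prover seat hodgecm-mathlib-F0P3a-p02 (g17): road «S3-ram» (LEAD F0P3a-plan (g12);
architect A-p16 (g31)), organ A′ (ii) (a2) — ENGINE ED. 3 «ROOT-REGION ASSEMBLY» INSTANTIATED IN THE DIAGONAL MODEL (the region twin of ★ J0 F0P2-p02 (g13)); 2026-09-02.
-/
import Literature.NumberTheory.Rogawski1990.DepthZeroKappaTransferTypeOneRamifiedRootRegionInduction   -- ★ p847420 (this seat): ENGINE ED. 3 (root-region assembly, generic rooted tree)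
import Literature.NumberTheory.Rogawski1990.DepthZeroKappaTransferTypeOneRamifiedDiagonalModel         -- ★ J0 p847449 (F0P2-p02 (g13)): the diagonal model's `hT hFfin hF hSD₁ hSD₂ hrF hrS` discharges
import HarnessLib

/-!
# The ramified type-(1) `κ`-orbital integral: the ROOT-REGION (axis) assembly of ENGINE ED. 3 instantiated in the DIAGONAL MODEL `(K³, diag d)` of a literal
# (Kottwitz 1986 §3; Rogawski 1990 §4.9; Bruhat–Tits 1972 §10; Serre, *Trees* II.1.1)

Topic `NumberTheory/Rogawski1990`; namespace `Literature.NumberTheory.Rogawski1990`.  THEOREMS ONLY (no definition, no instance, no notation, no named fact, no `sorry`); kernel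
lane `--supports stmt-HodgeConjecture-24833`.  Cell `pub/hodgecm-mathlib` (D-0151), crux H413; road «S3-ram» (count-neutral), P-1-ram organ A′ (ii) (a2); the region twin of
junction organ ★ J0 «THE ENGINE IN THE DIAGONAL MODEL» (F0P2-p02 (g13), p847449): there the two ROOT assemblies of the ★ engine (equilateral root ∕ ED. 2 axis family) are
instantiated with `G := latticeGraph σ ϖ (diag d)`, `r := L₀`, `F := Fix (latticeGraphIso T)`, `SD := IsSelfDualLattice` and the generic hypotheses `hT hFfin hF hSD₁ hSD₂ hrF
hrS` discharged by ★ J1 ∕ J2 ∕ J4a ∕ G1; HERE the same is done for ★ ENGINE ED. 3 (p847420, this seat): the ROOT-REGION assembly with a region `R ∋ r` given as a SET of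
vertices (the isoceles AXIS `{M = B ⊕ 𝒪e_u : level d₀}` of ★ `UnitaryLatticeTreeIsolatedIndexStableRoot`, or `{L₀}` in the equilateral configuration), the local law assumed
only OFF `R`, and the total either label-agnostic (`strataVec_total_eq_of_localLaw_of_rootRegion_diagonal`: `Σ_{v ∈ R} (e₄ + Σ_{w ∈ GC v ∖ R} T(label w))`) or with
`E ∕ P⁺ ∕ P⁻`-labelled off-region grandchildren and per-vertex multiplicities (`…_of_labels_diagonal`: `Σ_{v ∈ R} (e₄ + NE v·T(E_{k_v+1}) + NP v·T(P⁺_{k_v}) + NM v·T(P⁻_{k_v}))`,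
the shape the G6-lattice census delivers per ROOT ∕ INTERIOR ∕ END axis vertex).  Every LATTICE-SPECIFIC binder — labels `str dep rk cl` with `hstr`, `GC` with `hGC`, the
off-region laws `hrk … hP` (J6), the closed forms `TE TO TP` (★ ShellSums), the region data `R hrR hRF hRS hRdep hRup` and `sR sOff` ∕ `k NE NP NM hlabR` (J7) — is kept
VERBATIM for the junction heir.  HONEST LABEL: HC_CM is proved only modulo the 2 remaining named inputs (hLiu418 24832, h413 24833) until rung 0 closes; nothing printed is
asserted here (instantiation only).

## References
* [Kottwitz1986] R. E. Kottwitz, *Base change for unit elements of Hecke algebras*, Compositio Math. 60 (1986), §3 (counting fixed lattices).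
* [Rogawski1990] J. D. Rogawski, *Automorphic Representations of Unitary Groups in Three Variables*, Ann. of Math. Stud. 123 (1990), §4.9 pp. 54–56.
* [BruhatTits1972] F. Bruhat, J. Tits, *Groupes réductifs sur un corps local I*, Publ. Math. IHÉS 41 (1972), §10.
* [Serre1980Trees] J.-P. Serre, *Trees* (1980), I.2.3, II.1.1.
-/

set_option autoImplicit false

noncomputable section

open scoped Valued WithZero Matrix MatrixGroups
open SimpleGraph
open Literature.Combinatorics.SimpleGraph.TreeLayers
open Literature.NumberTheory.Automorphic Literature.NumberTheory.Automorphic.HermitianLattice Literature.NumberTheory.Automorphic.UnitaryLatticeTree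

namespace Literature.NumberTheory.Rogawski1990

variable {K : Type*} [Field K] [Valued K ℤᵐ⁰] {σ : K →+* K} {ϖ : K}

section Engine

variable [ValuativeRel K] [(Valued.v : Valuation K ℤᵐ⁰).Compatible] [Finite 𝓀[K]]

/-- **THE ROOT-REGION ASSEMBLY IN THE DIAGONAL MODEL, label-agnostic** (★ ENGINE ED. 3 `strataVec_total_eq_of_localLaw_of_rootRegion` with `G := latticeGraph σ ϖ (diag d)`,
`r := L₀`, `F := Fix T`, `SD := IsSelfDualLattice`, and `hT hFfin hF hSD₁ hSD₂` DISCHARGED as in ★ J0; `T = diag s` a unit diagonal element of `U(σ, diag d)` with regular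
residues witnessed by `δ`; region `R ∋ r` a set of fixed self-dual vertices of depth `≥ 2`, closed under fixed self-dual GC-parents; local law OFF `R`).
[cite: Kottwitz1986, §3] [cite: Rogawski1990, §4.9 pp. 54–56] [cite: BruhatTits1972, §10] -/
theorem strataVec_total_eq_of_localLaw_of_rootRegion_diagonal (hσ : ∀ x, σ (σ x) = x) (hvσ : ∀ a, Valued.v (σ a) = Valued.v a)
    (hϖ : Valued.v ϖ = WithZero.exp (-1 : ℤ)) (hσϖ : σ ϖ = -ϖ) (hres : ∀ x : K, Valued.v x ≤ 1 → Valued.v (σ x - x) < 1) (h2 : Valued.v (2 : K) = 1)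
    (hnorm : ∀ u : K, σ u = u → Valued.v (u - 1) < 1 → ∃ z : K, z * σ z = u ∧ Valued.v (z - 1) ≤ Valued.v (u - 1))
    (d : Fin 3 → K) (hd : ∀ i, Valued.v (d i) = 1) (hdσ : ∀ i, σ (d i) = d i)
    {s : Fin 3 → K} (hs : ∀ l, Valued.v (s l) = 1) {δ : K} (hδ0 : δ ≠ 0)
    (hδ : ∀ i j k : Fin 3, i ≠ j → i ≠ k → j ≠ k → Valued.v δ ≤ Valued.v ((s i - s j) * (s i - s k)))
    (T : unitaryGroupOfForm σ (Matrix.diagonal d)) (hT : ((T : GL (Fin 3) K) : Matrix (Fin 3) (Fin 3) K) = Matrix.diagonal s)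
    (r : {M : Submodule 𝒪[K] (Fin 3 → K) // IsVertex σ ϖ (Matrix.diagonal d) M}) (hr : r.1 = stdLattice K 3)
    (str : Fin 5 → {M : Submodule 𝒪[K] (Fin 3 → K) // IsVertex σ ϖ (Matrix.diagonal d) M} → Prop) [∀ j, DecidablePred (str j)]
    (dep rk : {M : Submodule 𝒪[K] (Fin 3 → K) // IsVertex σ ϖ (Matrix.diagonal d) M} → ℕ)
    (cl : {M : Submodule 𝒪[K] (Fin 3 → K) // IsVertex σ ϖ (Matrix.diagonal d) M} → ℤ)
    (hstr : ∀ w ∈ {v | latticeGraphIso σ ϖ (Matrix.diagonal d) T v = v}, IsSelfDualLattice σ ϖ (Matrix.diagonal d) w.1 →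
      (str 0 w ↔ dep w = 0) ∧ (str 1 w ↔ dep w = 1 ∧ rk w = 2) ∧ (str 2 w ↔ dep w = 1 ∧ rk w = 1 ∧ cl w = 1) ∧
      (str 3 w ↔ dep w = 1 ∧ rk w = 1 ∧ cl w = -1) ∧ (str 4 w ↔ 2 ≤ dep w))
    (GC : {M : Submodule 𝒪[K] (Fin 3 → K) // IsVertex σ ϖ (Matrix.diagonal d) M} → Set {M : Submodule 𝒪[K] (Fin 3 → K) // IsVertex σ ϖ (Matrix.diagonal d) M})
    (hGC : ∀ v w, w ∈ GC v ↔ ∃ c, ((latticeGraph σ ϖ (Matrix.diagonal d)).Adj v c ∧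
      (latticeGraph σ ϖ (Matrix.diagonal d)).dist r c = (latticeGraph σ ϖ (Matrix.diagonal d)).dist r v + 1 ∧ latticeGraphIso σ ϖ (Matrix.diagonal d) T c = c) ∧
      ((latticeGraph σ ϖ (Matrix.diagonal d)).Adj c w ∧ (latticeGraph σ ϖ (Matrix.diagonal d)).dist r w = (latticeGraph σ ϖ (Matrix.diagonal d)).dist r c + 1 ∧
        latticeGraphIso σ ϖ (Matrix.diagonal d) T w = w))
    (q : ℕ) (sgn : ℤ)
    (R : Set {M : Submodule 𝒪[K] (Fin 3 → K) // IsVertex σ ϖ (Matrix.diagonal d) M}) (hrR : r ∈ R) (hRF : R ⊆ {v | latticeGraphIso σ ϖ (Matrix.diagonal d) T v = v})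
    (hRS : ∀ v ∈ R, IsSelfDualLattice σ ϖ (Matrix.diagonal d) v.1) (hRdep : ∀ v ∈ R, 2 ≤ dep v)
    (hRup : ∀ v ∈ {v | latticeGraphIso σ ϖ (Matrix.diagonal d) T v = v}, IsSelfDualLattice σ ϖ (Matrix.diagonal d) v.1 → ∀ w ∈ GC v, w ∈ R → v ∈ R)
    (hrk : ∀ v ∈ {v | latticeGraphIso σ ϖ (Matrix.diagonal d) T v = v}, IsSelfDualLattice σ ϖ (Matrix.diagonal d) v.1 → v ∉ R → 1 ≤ dep v → rk v = 1 ∨ rk v = 2)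
    (hcl : ∀ v ∈ {v | latticeGraphIso σ ϖ (Matrix.diagonal d) T v = v}, IsSelfDualLattice σ ϖ (Matrix.diagonal d) v.1 → v ∉ R → rk v = 1 → cl v = 1 ∨ cl v = -1)
    (hodd : ∀ v ∈ {v | latticeGraphIso σ ϖ (Matrix.diagonal d) T v = v}, IsSelfDualLattice σ ϖ (Matrix.diagonal d) v.1 → v ∉ R → 2 ≤ dep v → rk v = 1 → Odd (dep v))
    (hB : ∀ v ∈ {v | latticeGraphIso σ ϖ (Matrix.diagonal d) T v = v}, IsSelfDualLattice σ ϖ (Matrix.diagonal d) v.1 → v ∉ R → dep v = 0 → GC v = ∅)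
    (hC : ∀ v ∈ {v | latticeGraphIso σ ϖ (Matrix.diagonal d) T v = v}, IsSelfDualLattice σ ϖ (Matrix.diagonal d) v.1 → v ∉ R → dep v = 1 → rk v = 1 → GC v = ∅)
    (hR : ∀ v ∈ {v | latticeGraphIso σ ϖ (Matrix.diagonal d) T v = v}, IsSelfDualLattice σ ϖ (Matrix.diagonal d) v.1 → v ∉ R → dep v = 1 → rk v = 2 →
      (∀ w ∈ GC v, dep w = 0) ∧ (GC v).ncard = q)
    (hE : ∀ v ∈ {v | latticeGraphIso σ ϖ (Matrix.diagonal d) T v = v}, IsSelfDualLattice σ ϖ (Matrix.diagonal d) v.1 → v ∉ R → ∀ m, dep v = 2 * m + 2 → rk v = 2 →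
      (∀ w ∈ GC v, dep w = 2 * m + 1 ∧ rk w = 2) ∧ (GC v).ncard = q ^ 2)
    (hO : ∀ v ∈ {v | latticeGraphIso σ ϖ (Matrix.diagonal d) T v = v}, IsSelfDualLattice σ ϖ (Matrix.diagonal d) v.1 → v ∉ R → ∀ m, dep v = 2 * m + 3 → rk v = 2 →
      (∀ w ∈ GC v, (dep w = 2 * m + 2 ∧ rk w = 2) ∨ (dep w = 2 * m + 1 ∧ rk w = 1 ∧ (cl w = 1 ∨ cl w = -1))) ∧
        {w | w ∈ GC v ∧ dep w = 2 * m + 2}.ncard = q ∧ {w | w ∈ GC v ∧ dep w = 2 * m + 1 ∧ cl w = 1}.ncard = q.choose 2 ∧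
          {w | w ∈ GC v ∧ dep w = 2 * m + 1 ∧ cl w = -1}.ncard = q.choose 2)
    (hP : ∀ v ∈ {v | latticeGraphIso σ ϖ (Matrix.diagonal d) T v = v}, IsSelfDualLattice σ ϖ (Matrix.diagonal d) v.1 → v ∉ R → ∀ m (c : ℤ), dep v = 2 * m + 3 → rk v = 1 →
      cl v = c → (∀ w ∈ GC v, dep w = 2 * m + 1 ∧ rk w = 1 ∧ cl w = sgn * c) ∧ (GC v).ncard = q ^ 2)
    (TE TO : ℕ → Fin 5 → ℕ) (TP : ℤ → ℕ → Fin 5 → ℕ)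
    (hTE : ∀ m, TE (m + 1) = ![0, 0, 0, 0, 1] + q ^ 2 • TO m)
    (hTO0 : TO 0 = ![0, 1, 0, 0, 0] + q • ![1, 0, 0, 0, 0])
    (hTOs : ∀ m, TO (m + 1) = ![0, 0, 0, 0, 1] + q • TE (m + 1) + q.choose 2 • (TP 1 m + TP (-1) m))
    (hTP0 : TP 1 0 = ![0, 0, 1, 0, 0]) (hTP0' : TP (-1) 0 = ![0, 0, 0, 1, 0])
    (hTPs : ∀ m (c : ℤ), c = 1 ∨ c = -1 → TP c (m + 1) = ![0, 0, 0, 0, 1] + q ^ 2 • TP (sgn * c) m)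
    (sR : Finset {M : Submodule 𝒪[K] (Fin 3 → K) // IsVertex σ ϖ (Matrix.diagonal d) M}) (hsR : ∀ v, v ∈ sR ↔ v ∈ R)
    (sOff : {M : Submodule 𝒪[K] (Fin 3 → K) // IsVertex σ ϖ (Matrix.diagonal d) M} → Finset {M : Submodule 𝒪[K] (Fin 3 → K) // IsVertex σ ϖ (Matrix.diagonal d) M})
    (hsOff : ∀ v ∈ R, ∀ w, w ∈ sOff v ↔ w ∈ GC v ∧ w ∉ R) :
    (fun j => ({v | latticeGraphIso σ ϖ (Matrix.diagonal d) T v = v} ∩ {w | IsSelfDualLattice σ ϖ (Matrix.diagonal d) w.1 ∧ str j w}).ncard) =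
      ∑ v ∈ sR, ((![0, 0, 0, 0, 1] : Fin 5 → ℕ) + ∑ w ∈ sOff v,
        (if dep w = 0 then ![1, 0, 0, 0, 0]
          else if rk w = 2 then (if Even (dep w) then TE (dep w / 2) else TO (dep w / 2)) else TP (cl w) (dep w / 2))) := by
  classical
  have hTree := isTree_latticeGraph_three_diagonal_of_neg hσ hvσ hϖ hσϖ hres h2 hnorm d hd hdσ
  exact strataVec_total_eq_of_localLaw_of_rootRegion hTree r {v | latticeGraphIso σ ϖ (Matrix.diagonal d) T v = v}
    (finite_setOf_latticeGraphIso_diagonal_eq hvσ hϖ hd (fun l => (hs l).le) hδ0 hδ T hT)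
    (parentClosed_setOf_latticeGraphIso_diagonal_eq hTree T hT hs r hr) (fun v => IsSelfDualLattice σ ϖ (Matrix.diagonal d) v.1) str
    (fun v c hvc hv => not_isSelfDualLattice_of_adj_diagonal hσ hvσ hϖ hres h2 hnorm d hd hdσ v c hvc hv)
    (fun c w hcw hc => isSelfDualLattice_of_adj_of_not_diagonal hσ hvσ hϖ hres h2 hnorm d hd hdσ c w hcw hc)
    dep rk cl hstr GC hGC q sgn R hrR hRF hRS hRdep hRup hrk hcl hodd hB hC hR hE hO hP TE TO TP hTE hTO0 hTOs hTP0 hTP0' hTPs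
    sR hsR sOff hsOff

/-- **THE ROOT-REGION ASSEMBLY IN THE DIAGONAL MODEL, labelled form** (★ ENGINE ED. 3 `strataVec_total_eq_of_localLaw_of_rootRegion_of_labels`, same instantiation and
discharges): off-region grandchildren of each region vertex `v` of labels `E_{k_v+1} ∕ P⁺_{k_v} ∕ P⁻_{k_v}` with multiplicities `NE v ∕ NP v ∕ NM v` (the G6-lattice
census per ROOT ∕ INTERIOR ∕ END axis vertex) ⇒ TOTAL `= Σ_{v ∈ R} (e₄ + NE v•TE (k v + 1) + NP v•TP 1 (k v) + NM v•TP (−1) (k v))`.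
[cite: Kottwitz1986, §3] [cite: Rogawski1990, §4.9 pp. 54–56] [cite: BruhatTits1972, §10] -/
theorem strataVec_total_eq_of_localLaw_of_rootRegion_of_labels_diagonal (hσ : ∀ x, σ (σ x) = x) (hvσ : ∀ a, Valued.v (σ a) = Valued.v a)
    (hϖ : Valued.v ϖ = WithZero.exp (-1 : ℤ)) (hσϖ : σ ϖ = -ϖ) (hres : ∀ x : K, Valued.v x ≤ 1 → Valued.v (σ x - x) < 1) (h2 : Valued.v (2 : K) = 1)
    (hnorm : ∀ u : K, σ u = u → Valued.v (u - 1) < 1 → ∃ z : K, z * σ z = u ∧ Valued.v (z - 1) ≤ Valued.v (u - 1))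
    (d : Fin 3 → K) (hd : ∀ i, Valued.v (d i) = 1) (hdσ : ∀ i, σ (d i) = d i)
    {s : Fin 3 → K} (hs : ∀ l, Valued.v (s l) = 1) {δ : K} (hδ0 : δ ≠ 0)
    (hδ : ∀ i j k : Fin 3, i ≠ j → i ≠ k → j ≠ k → Valued.v δ ≤ Valued.v ((s i - s j) * (s i - s k)))
    (T : unitaryGroupOfForm σ (Matrix.diagonal d)) (hT : ((T : GL (Fin 3) K) : Matrix (Fin 3) (Fin 3) K) = Matrix.diagonal s)
    (r : {M : Submodule 𝒪[K] (Fin 3 → K) // IsVertex σ ϖ (Matrix.diagonal d) M}) (hr : r.1 = stdLattice K 3)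
    (str : Fin 5 → {M : Submodule 𝒪[K] (Fin 3 → K) // IsVertex σ ϖ (Matrix.diagonal d) M} → Prop) [∀ j, DecidablePred (str j)]
    (dep rk : {M : Submodule 𝒪[K] (Fin 3 → K) // IsVertex σ ϖ (Matrix.diagonal d) M} → ℕ)
    (cl : {M : Submodule 𝒪[K] (Fin 3 → K) // IsVertex σ ϖ (Matrix.diagonal d) M} → ℤ)
    (hstr : ∀ w ∈ {v | latticeGraphIso σ ϖ (Matrix.diagonal d) T v = v}, IsSelfDualLattice σ ϖ (Matrix.diagonal d) w.1 →
      (str 0 w ↔ dep w = 0) ∧ (str 1 w ↔ dep w = 1 ∧ rk w = 2) ∧ (str 2 w ↔ dep w = 1 ∧ rk w = 1 ∧ cl w = 1) ∧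
      (str 3 w ↔ dep w = 1 ∧ rk w = 1 ∧ cl w = -1) ∧ (str 4 w ↔ 2 ≤ dep w))
    (GC : {M : Submodule 𝒪[K] (Fin 3 → K) // IsVertex σ ϖ (Matrix.diagonal d) M} → Set {M : Submodule 𝒪[K] (Fin 3 → K) // IsVertex σ ϖ (Matrix.diagonal d) M})
    (hGC : ∀ v w, w ∈ GC v ↔ ∃ c, ((latticeGraph σ ϖ (Matrix.diagonal d)).Adj v c ∧
      (latticeGraph σ ϖ (Matrix.diagonal d)).dist r c = (latticeGraph σ ϖ (Matrix.diagonal d)).dist r v + 1 ∧ latticeGraphIso σ ϖ (Matrix.diagonal d) T c = c) ∧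
      ((latticeGraph σ ϖ (Matrix.diagonal d)).Adj c w ∧ (latticeGraph σ ϖ (Matrix.diagonal d)).dist r w = (latticeGraph σ ϖ (Matrix.diagonal d)).dist r c + 1 ∧
        latticeGraphIso σ ϖ (Matrix.diagonal d) T w = w))
    (q : ℕ) (sgn : ℤ)
    (R : Set {M : Submodule 𝒪[K] (Fin 3 → K) // IsVertex σ ϖ (Matrix.diagonal d) M}) (hrR : r ∈ R) (hRF : R ⊆ {v | latticeGraphIso σ ϖ (Matrix.diagonal d) T v = v})
    (hRS : ∀ v ∈ R, IsSelfDualLattice σ ϖ (Matrix.diagonal d) v.1) (hRdep : ∀ v ∈ R, 2 ≤ dep v)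
    (hRup : ∀ v ∈ {v | latticeGraphIso σ ϖ (Matrix.diagonal d) T v = v}, IsSelfDualLattice σ ϖ (Matrix.diagonal d) v.1 → ∀ w ∈ GC v, w ∈ R → v ∈ R)
    (hrk : ∀ v ∈ {v | latticeGraphIso σ ϖ (Matrix.diagonal d) T v = v}, IsSelfDualLattice σ ϖ (Matrix.diagonal d) v.1 → v ∉ R → 1 ≤ dep v → rk v = 1 ∨ rk v = 2)
    (hcl : ∀ v ∈ {v | latticeGraphIso σ ϖ (Matrix.diagonal d) T v = v}, IsSelfDualLattice σ ϖ (Matrix.diagonal d) v.1 → v ∉ R → rk v = 1 → cl v = 1 ∨ cl v = -1)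
    (hodd : ∀ v ∈ {v | latticeGraphIso σ ϖ (Matrix.diagonal d) T v = v}, IsSelfDualLattice σ ϖ (Matrix.diagonal d) v.1 → v ∉ R → 2 ≤ dep v → rk v = 1 → Odd (dep v))
    (hB : ∀ v ∈ {v | latticeGraphIso σ ϖ (Matrix.diagonal d) T v = v}, IsSelfDualLattice σ ϖ (Matrix.diagonal d) v.1 → v ∉ R → dep v = 0 → GC v = ∅)
    (hC : ∀ v ∈ {v | latticeGraphIso σ ϖ (Matrix.diagonal d) T v = v}, IsSelfDualLattice σ ϖ (Matrix.diagonal d) v.1 → v ∉ R → dep v = 1 → rk v = 1 → GC v = ∅)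
    (hR : ∀ v ∈ {v | latticeGraphIso σ ϖ (Matrix.diagonal d) T v = v}, IsSelfDualLattice σ ϖ (Matrix.diagonal d) v.1 → v ∉ R → dep v = 1 → rk v = 2 →
      (∀ w ∈ GC v, dep w = 0) ∧ (GC v).ncard = q)
    (hE : ∀ v ∈ {v | latticeGraphIso σ ϖ (Matrix.diagonal d) T v = v}, IsSelfDualLattice σ ϖ (Matrix.diagonal d) v.1 → v ∉ R → ∀ m, dep v = 2 * m + 2 → rk v = 2 →
      (∀ w ∈ GC v, dep w = 2 * m + 1 ∧ rk w = 2) ∧ (GC v).ncard = q ^ 2)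
    (hO : ∀ v ∈ {v | latticeGraphIso σ ϖ (Matrix.diagonal d) T v = v}, IsSelfDualLattice σ ϖ (Matrix.diagonal d) v.1 → v ∉ R → ∀ m, dep v = 2 * m + 3 → rk v = 2 →
      (∀ w ∈ GC v, (dep w = 2 * m + 2 ∧ rk w = 2) ∨ (dep w = 2 * m + 1 ∧ rk w = 1 ∧ (cl w = 1 ∨ cl w = -1))) ∧
        {w | w ∈ GC v ∧ dep w = 2 * m + 2}.ncard = q ∧ {w | w ∈ GC v ∧ dep w = 2 * m + 1 ∧ cl w = 1}.ncard = q.choose 2 ∧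
          {w | w ∈ GC v ∧ dep w = 2 * m + 1 ∧ cl w = -1}.ncard = q.choose 2)
    (hP : ∀ v ∈ {v | latticeGraphIso σ ϖ (Matrix.diagonal d) T v = v}, IsSelfDualLattice σ ϖ (Matrix.diagonal d) v.1 → v ∉ R → ∀ m (c : ℤ), dep v = 2 * m + 3 → rk v = 1 →
      cl v = c → (∀ w ∈ GC v, dep w = 2 * m + 1 ∧ rk w = 1 ∧ cl w = sgn * c) ∧ (GC v).ncard = q ^ 2)
    (TE TO : ℕ → Fin 5 → ℕ) (TP : ℤ → ℕ → Fin 5 → ℕ)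
    (hTE : ∀ m, TE (m + 1) = ![0, 0, 0, 0, 1] + q ^ 2 • TO m)
    (hTO0 : TO 0 = ![0, 1, 0, 0, 0] + q • ![1, 0, 0, 0, 0])
    (hTOs : ∀ m, TO (m + 1) = ![0, 0, 0, 0, 1] + q • TE (m + 1) + q.choose 2 • (TP 1 m + TP (-1) m))
    (hTP0 : TP 1 0 = ![0, 0, 1, 0, 0]) (hTP0' : TP (-1) 0 = ![0, 0, 0, 1, 0])
    (hTPs : ∀ m (c : ℤ), c = 1 ∨ c = -1 → TP c (m + 1) = ![0, 0, 0, 0, 1] + q ^ 2 • TP (sgn * c) m)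
    (sR : Finset {M : Submodule 𝒪[K] (Fin 3 → K) // IsVertex σ ϖ (Matrix.diagonal d) M}) (hsR : ∀ v, v ∈ sR ↔ v ∈ R)
    (k NE NP NM : {M : Submodule 𝒪[K] (Fin 3 → K) // IsVertex σ ϖ (Matrix.diagonal d) M} → ℕ)
    (hlabR : ∀ v ∈ R, (∀ w ∈ GC v, w ∉ R → (dep w = 2 * k v + 2 ∧ rk w = 2) ∨ (dep w = 2 * k v + 1 ∧ rk w = 1 ∧ (cl w = 1 ∨ cl w = -1))) ∧
      {w | w ∈ GC v ∧ w ∉ R ∧ dep w = 2 * k v + 2}.ncard = NE v ∧ {w | w ∈ GC v ∧ w ∉ R ∧ dep w = 2 * k v + 1 ∧ cl w = 1}.ncard = NP v ∧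
        {w | w ∈ GC v ∧ w ∉ R ∧ dep w = 2 * k v + 1 ∧ cl w = -1}.ncard = NM v) :
    (fun j => ({v | latticeGraphIso σ ϖ (Matrix.diagonal d) T v = v} ∩ {w | IsSelfDualLattice σ ϖ (Matrix.diagonal d) w.1 ∧ str j w}).ncard) =
      ∑ v ∈ sR, ((![0, 0, 0, 0, 1] : Fin 5 → ℕ) + NE v • TE (k v + 1) + NP v • TP 1 (k v) + NM v • TP (-1) (k v)) := by
  classical
  have hTree := isTree_latticeGraph_three_diagonal_of_neg hσ hvσ hϖ hσϖ hres h2 hnorm d hd hdσ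
  exact strataVec_total_eq_of_localLaw_of_rootRegion_of_labels hTree r {v | latticeGraphIso σ ϖ (Matrix.diagonal d) T v = v}
    (finite_setOf_latticeGraphIso_diagonal_eq hvσ hϖ hd (fun l => (hs l).le) hδ0 hδ T hT)
    (parentClosed_setOf_latticeGraphIso_diagonal_eq hTree T hT hs r hr) (fun v => IsSelfDualLattice σ ϖ (Matrix.diagonal d) v.1) str
    (fun v c hvc hv => not_isSelfDualLattice_of_adj_diagonal hσ hvσ hϖ hres h2 hnorm d hd hdσ v c hvc hv)
    (fun c w hcw hc => isSelfDualLattice_of_adj_of_not_diagonal hσ hvσ hϖ hres h2 hnorm d hd hdσ c w hcw hc)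
    dep rk cl hstr GC hGC q sgn R hrR hRF hRS hRdep hRup hrk hcl hodd hB hC hR hE hO hP TE TO TP hTE hTO0 hTOs hTP0 hTP0' hTPs
    sR hsR k NE NP NM hlabR

end Engine

end Literature.NumberTheory.Rogawski1990

end
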